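import Summits.AtomisticToContinuum.BoseEinsteinCondensation.Theses.BECInfraredBound


/-!
# Crux `BecUvTail` (stmt-AtomisticToContinuum-8823) — `Lines/birth.lean`

BC3 birth skeleton for the rank-3 crux of route `BECInfraredBound`
(sub-problem `BoseEinsteinCondensation`): the SUMMED ULTRAVIOLET TAIL of the inner-box plane-wave
occupations of Dirichlet δ-near-minimisers — for every repulsive finite-range `v` there are `K > 0`
and `θ < 1` such that for every `ε ∈ (0,1/4)`, all small `ρ`, all large `N`, some `δ > 0` and every
δ-near-minimiser `Ψ` in the box of side `L = (N/ρ)^{1/3}`,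
`Σ_{‖k‖∞ > K√ρ·L} ⟨φ'_k, γ_Ψ φ'_k⟩ ≤ θ N`, where `φ'_k = L'^{-3/2} e^{2πi k·x/L'} 1_{Λ'}`,
`Λ' = (εL, L−εL)³`, `L' = (1−2ε)L` (sup norm on `k ∈ ℤ³`; `tsum` over the subtype in `ℝ≥0∞`).

## The line: KINETIC BUDGET + FIRST-ORDER (TRACE-KEEPING) MOMENTUM LOCALISATION

The sharp window `1_{Λ'}` forbids the kinetic Chebyshev bound (`Σ‖k‖²⟨φ'_k,γφ'_k⟩ = ∞`: the
windowed slices do not vanish at `∂Λ'`), but a FIRST-ORDER integration by parts survives it: for a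
`C¹` slice `g` on an interval `I` of length `L'`, with `c_k = ⟨L'^{-1/2}e^{2πik·/L'}, g⟩`,
`c_k = (L'^{1/2}/(2πik))·(−(g(b)−g(a))·phase + L'^{-1/2}∫ g' e_k)`, whence
`Σ_{|k|>K'} |c_k|² ≤ (4/π²)(1/K' + 1/K'²)(‖g‖² + 2L'‖g‖‖g'‖) + L'²‖g'‖²/(2π²K'²)`
(boundary trace by the 1-D Agmon bound `sup|g|² ≤ ‖g‖²/L' + 2‖g‖‖g'‖`, bulk term by Bessel for `g'`).
Bessel in the two transverse directions, Tonelli over the other `N−1` particles, Cauchy–Schwarz and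
the union bound over the three coordinate directions (`{‖k‖∞ > K'} ⊆ ⋃_j {|k_j| > K'}`) give, for
EVERY trial state `Ψ` with kinetic energy `T = ∫|∇Ψ|²`,
`tail(K') ≤ (12/π²)(1/K'+1/K'²)·N + (8/π²)(1/K'+1/K'²)·L'·√(3NT) + L'²T/(2π²K'²)`.
With `K' = K√ρL`, `L' ≤ L` and a kinetic budget `T ≤ CρN`: `tail/N ≤ o_N(1) + 8√(3C)/(π²K)·(1+o_N(1))
+ C/(2π²K²)`, which is `≤ 1/2` for `K = K(C)` large and `N` large — uniformly in `ε` and `ρ`.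
The kinetic budget for δ-near-minimisers is the energy input: `T ≤ E ≤ E₀ + δ` (`v ≥ 0`) and
`E₀ ≤ 4πρa(1 + C(ρa³)^{1/3})N ≤ 8πaρN` for small `ρ` and large `N` (Dyson's upper bound, in tree:
`eventually_groundStateEnergy_le_dyson`; `a(v) < ∞` is automatic for finite range,
`IsRepulsiveFiniteRange.scatteringLength_ne_top`; the corner `a(v) = 0` by monotonicity in `v` or
the free gas). Hence two stubs:

* `stub_kineticBudget` — A-PRIORI KINETIC BUDGET OF DIRICHLET NEAR-MINIMISERS (size M, provable now
  from in-tree facts): for every repulsive finite-range `v` there are `C, ρ₀ > 0` such that for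
  `0 < ρ < ρ₀`, all large `N`, some `δ > 0`, every δ-near-minimiser has `∫|∇Ψ|² ≤ CρN`.
* `stub_uvTailOfKineticBudget` — MOMENTUM LOCALISATION FROM A KINETIC BUDGET THROUGH THE SHARP INNER
  WINDOW (the load-bearing analytic stub, size L): for every `C > 0` there are `K > 0`, `θ < 1` such
  that for every `ε ∈ (0,1/4)`, every `ρ > 0`, all large `N` and EVERY trial state `Ψ` in the box of
  side `(N/ρ)^{1/3}` with `∫|∇Ψ|² ≤ CρN`, the summed tail beyond `‖k‖∞ > K√ρL` is `≤ θN`. No `v`,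
  no near-minimiser: a one-body Sobolev-trace statement about the one-particle density matrix.

`BecUvTail_of : stub₁-sig → stub₂-sig → BecUvTail` is a REAL PROOF (pure logic: `C` from stub 1
feeds stub 2; `ρ₀` from stub 1; intersect the two eventualities; `δ` from stub 1). The stub
signatures enter BY REGISTERED NAME through the reducible aliases `__Registered.stub_X` (= the
verbatim signatures; the native skeleton audit admits a `Prop` hypothesis only if its head constant
is a registered obligation or is named like a declared stub — device of
`Cruxes/AmplitudeLDP/Lines/birth.lean`, `Cruxes/BlockInfraredBound/Lines/birth.lean`).
`BecUvTail_of_stubs : BecUvTail` applies it to the stubs.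

Why this is not shredding/costume: stub 1 is an ENERGY statement (no occupations), stub 2 an
occupation statement for ARBITRARY states under a kinetic hypothesis (no potential, no ground
state); neither mentions `λ_max`/`condensateNumber`/`HasGroundStateBEC`; the crux needs both
(probes `stub → BecUvTail`, `stub → BoseEinsteinCondensation` by `first | exact? | simpa | aesop`
fail, files `bc/probe_*.lean` of the registering seat). Honours the refuter derivations on the item
(rattack-8823 `EVIDENCE_BecUvTail.md`, rreview1; grounders g26-5/g26-9: "new as a lemma, provable
now"): this skeleton is exactly their two-step recipe, typed. Disproof used: none on file
(`ledger crux ls stmt-AtomisticToContinuum-8823`: no `Disproof.lean`, no prior lines).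
Negatives index (`ledger negatives --problem AtomisticToContinuum`): no entry is an instance of a stub.
Degenerate cases: `N = 0` (no trial states / `occupation 0 = 0`) is killed by `∀ᶠ N`; `θ` may be
taken `1/2`; free gas `v ≡ 0`: stub 1 holds with `E₀ = 3π²N/L² ≪ ρN`, stub 2 is `v`-free.
-/

namespace Summit.AtomisticToContinuum.BoseEinsteinCondensation.Cruxes.BecUvTail.Birth

open MeasureTheory
open scoped ENNReal


/-! ### The two stubs -/

/-- STUB 1 — A-PRIORI KINETIC BUDGET OF DIRICHLET δ-NEAR-MINIMISERS (size M, provable now). For every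
repulsive finite-range `v` there are `C > 0` and `ρ₀ > 0` such that for all `0 < ρ < ρ₀`, all large
`N`, some `δ > 0` and every trial state `Ψ` in the box of side `L = (N/ρ)^{1/3}` with
`energy v Ψ ≤ E₀(N, L) + δ`, the kinetic energy satisfies `∫ |∇Ψ|² ≤ C ρ N`.
Proof plan: `∫|∇Ψ|² ≤ energy v Ψ` (`v ≥ 0` in `ℝ≥0∞`); if `a(v) > 0`, Dyson's upper bound
`E₀ ≤ 4πρa(1 + C'(ρa³)^{1/3}) N` eventually (in tree: `eventually_groundStateEnergy_le_dyson`, with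
`a < ∞` from `IsRepulsiveFiniteRange.scatteringLength_ne_top`) and `δ := ofReal (ρN)`; if
`a(v) = 0`, either compare `v ≤ v + 1_{[0,1]}` (energy and `E₀` are monotone in `v`) or use the free
Dirichlet gas `E₀ = 3π²N/L² = 3π²ρ^{2/3}N^{1/3} ≤ ρN` eventually. Why it might fail: only formally
(the `a = 0` corner; `E₀ < ⊤` needed to make `E₀ + δ` a genuine slack).
[cite: LSSY2005, Thm 2.2 (2.14)–(2.15); LiebYngvason1998] -/
theorem stub_kineticBudget :
    ∀ v : ℝ → ENNReal, Literature.MathematicalPhysics.QuantumManyBody.BoseGas.IsRepulsiveFiniteRange v → ∃ C : ℝ, 0 < C ∧ ∃ ρ₀ : ℝ, 0 < ρ₀ ∧ ∀ ρ : ℝ, 0 < ρ → ρ < ρ₀ → ∀ᶠ N : ℕ in Filter.atTop, ∃ δ : ENNReal, 0 < δ ∧ ∀ Ψ : Literature.MathematicalPhysics.QuantumManyBody.BoseGas.TrialState N (Literature.MathematicalPhysics.QuantumManyBody.BoseGas.sideLength ρ N), Literature.MathematicalPhysics.QuantumManyBody.BoseGas.energy v Ψ ≤ Literature.MathematicalPhysics.QuantumManyBody.BoseGas.groundStateEnergy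 v N (Literature.MathematicalPhysics.QuantumManyBody.BoseGas.sideLength ρ N) + δ → (∫⁻ X, Literature.MathematicalPhysics.QuantumManyBody.BoseGas.kineticDensity Ψ.ψ X) ≤ ENNReal.ofReal (C * ρ * N) := by
  sorry

/-- STUB 2 — MOMENTUM LOCALISATION FROM A KINETIC BUDGET THROUGH THE SHARP INNER WINDOW (the
load-bearing analytic stub, size L). For every `C > 0` there are `K > 0` and `θ < 1` such that for
every `ε ∈ (0,1/4)`, every `ρ > 0`, all large `N` and EVERY trial state `Ψ` in the box of side
`L = (N/ρ)^{1/3}` with `∫ |∇Ψ|² ≤ C ρ N`, the summed occupation of the inner-box plane waves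
`φ'_k = L'^{-3/2} e^{2πik·x/L'} 1_{Λ'}` (`Λ' = (εL, L−εL)³`, `L' = (1−2ε)L`) beyond the infrared window,
`Σ_{‖k‖∞ > K√ρL} ⟨φ'_k, γ_Ψ φ'_k⟩` (the crux's tail, verbatim), is `≤ θ N`.
Proof plan (refuters rattack-8823 / rreview1, grounder g26-5): 1-D first-order IBP tail lemma for `C¹`
slices on `[εL, L−εL]` WITH their non-zero boundary traces,
`Σ_{|k|>K'} |c_k|² ≤ (4/π²)(1/K'+1/K'²)(‖g‖² + 2L'‖g‖‖g'‖) + L'²‖g'‖²/(2π²K'²)` (Agmon trace bound +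
Bessel for `g'`); Bessel in the transverse directions; Tonelli over the spectators; Cauchy–Schwarz;
union bound over the three directions: `tail ≤ (12/π²)(1/K'+1/K'²)N + (8/π²)(1/K'+1/K'²)L'√(3N·T)
+ L'²T/(2π²K'²)` with `K' = K√ρL → ∞`, `L' ≤ L`, `T ≤ CρN`, i.e. `tail/N ≤ o(1) + 8√(3C)/(π²K) +
C/(2π²K²) ≤ 1/2` for `K = K(C)`; `θ = 1/2`. Why it might fail: only if the trace term were not
`O(N/K)` uniformly in `ε` (it is: `L'/K' ≤ 1/(K√ρ)` cancels against `√(T/N) ≤ √(Cρ)`); Lean size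
(slice regularity of `C¹` maps, Fourier/Bessel on an interval for `occupation`, `tsum` over a union of
three half-lattices). [cite: LSSY2005, Ch. 5; DysonLiebSimon1978, §1 (mode counting)] -/
theorem stub_uvTailOfKineticBudget :
    ∀ C : ℝ, 0 < C → ∃ K : ℝ, 0 < K ∧ ∃ θ : ℝ, θ < 1 ∧ ∀ ε : ℝ, 0 < ε → ε < 1 / 4 → ∀ ρ : ℝ, 0 < ρ → ∀ᶠ N : ℕ in Filter.atTop, ∀ Ψ : Literature.MathematicalPhysics.QuantumManyBody.BoseGas.TrialState N (Literature.MathematicalPhysics.QuantumManyBody.BoseGas.sideLength ρ N), (∫⁻ X, Literature.MathematicalPhysics.QuantumManyBody.BoseGas.kineticDensity Ψ.ψ X) ≤ ENNReal.ofReal (C * ρ * N) → ∑' k : {k : Fin 3 → ℤ // K * Real.sqrt ρ * Literature.MathematicalPhysics.QuantumManyBody.BoseGas.sideLength ρ N < ‖(fun j => (k j : ℝ))‖}, Literature.MathematicalPhysics.QuantumManyBody.BoseGas.occupation N ({x : EuclideanSpace ℝ (Fin 3) | ∀ j, x j ∈ Set.Ioo (ε * Literature.MathematicalPhysics.QuantumManyBody.BoseGas.sideLength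 ρ N) (Literature.MathematicalPhysics.QuantumManyBody.BoseGas.sideLength ρ N - ε * Literature.MathematicalPhysics.QuantumManyBody.BoseGas.sideLength ρ N)}.indicator fun x => ((Real.sqrt (((1 - 2 * ε) * Literature.MathematicalPhysics.QuantumManyBody.BoseGas.sideLength ρ N) ^ 3))⁻¹ : ℂ) * Complex.exp (Complex.I * ↑(2 * Real.pi / ((1 - 2 * ε) * Literature.MathematicalPhysics.QuantumManyBody.BoseGas.sideLength ρ N) * ∑ j, ((k : Fin 3 → ℤ) j : ℝ) * x j))) Ψ.ψ ≤ ENNReal.ofReal (θ * N) := by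
  sorry

/-! ### Registered-name aliases of the stub statements

The native skeleton audit (`#h21_check_skeleton`, run by `ledger skeleton check`) admits a `Prop`
hypothesis of the skeleton theorem only if its HEAD CONSTANT is a registered obligation or is NAMED
like a declared stub. A verbatim `∀ …` signature has no head constant, so both stubs enter
`BecUvTail_of` through the aliases below: `__Registered.stub_X` is the statement of `stub_X`,
character for character, under that name (reducible, definitionally equal — `BecUvTail_of_stubs`
feeds the theorems `stub_X` straight in). The `__` namespace is an implementation detail skipped by
the audit's declaration scan, so the registered stubs remain the sorried THEOREMS `stub_X` with their
full self-contained signatures (device of `Cruxes/AmplitudeLDP/Lines/birth.lean`). -/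
namespace __Registered

/-- The statement of `stub_kineticBudget`, verbatim, keyed by the registered stub name. -/
abbrev stub_kineticBudget : Prop :=
    ∀ v : ℝ → ENNReal, Literature.MathematicalPhysics.QuantumManyBody.BoseGas.IsRepulsiveFiniteRange v → ∃ C : ℝ, 0 < C ∧ ∃ ρ₀ : ℝ, 0 < ρ₀ ∧ ∀ ρ : ℝ, 0 < ρ → ρ < ρ₀ → ∀ᶠ N : ℕ in Filter.atTop, ∃ δ : ENNReal, 0 < δ ∧ ∀ Ψ : Literature.MathematicalPhysics.QuantumManyBody.BoseGas.TrialState N (Literature.MathematicalPhysics.QuantumManyBody.BoseGas.sideLength ρ N), Literature.MathematicalPhysics.QuantumManyBody.BoseGas.energy v Ψ ≤ Literature.MathematicalPhysics.QuantumManyBody.BoseGas.groundStateEnergy v N (Literature.MathematicalPhysics.QuantumManyBody.BoseGas.sideLength ρ N) + δ → (∫⁻ X, Literature.MathematicalPhysics.QuantumManyBody.BoseGas.kineticDensity Ψ.ψ X) ≤ ENNReal.ofReal (C * ρ * N)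

/-- The statement of `stub_uvTailOfKineticBudget`, verbatim, keyed by the registered stub name. -/
abbrev stub_uvTailOfKineticBudget : Prop :=
    ∀ C : ℝ, 0 < C → ∃ K : ℝ, 0 < K ∧ ∃ θ : ℝ, θ < 1 ∧ ∀ ε : ℝ, 0 < ε → ε < 1 / 4 → ∀ ρ : ℝ, 0 < ρ → ∀ᶠ N : ℕ in Filter.atTop, ∀ Ψ : Literature.MathematicalPhysics.QuantumManyBody.BoseGas.TrialState N (Literature.MathematicalPhysics.QuantumManyBody.BoseGas.sideLength ρ N), (∫⁻ X, Literature.MathematicalPhysics.QuantumManyBody.BoseGas.kineticDensity Ψ.ψ X) ≤ ENNReal.ofReal (C * ρ * N) → ∑' k : {k : Fin 3 → ℤ // K * Real.sqrt ρ * Literature.MathematicalPhysics.QuantumManyBody.BoseGas.sideLength ρ N < ‖(fun j => (k j : ℝ))‖}, Literature.MathematicalPhysics.QuantumManyBody.BoseGas.occupation N ({x : EuclideanSpace ℝ (Fin 3) | ∀ j, x j ∈ Set.Ioo (ε * Literature.MathematicalPhysics.QuantumManyBody.BoseGas.sideLength ρ N) (Literature.MathematicalPhysics.QuantumManyBody.BoseGas.sideLength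 ρ N - ε * Literature.MathematicalPhysics.QuantumManyBody.BoseGas.sideLength ρ N)}.indicator fun x => ((Real.sqrt (((1 - 2 * ε) * Literature.MathematicalPhysics.QuantumManyBody.BoseGas.sideLength ρ N) ^ 3))⁻¹ : ℂ) * Complex.exp (Complex.I * ↑(2 * Real.pi / ((1 - 2 * ε) * Literature.MathematicalPhysics.QuantumManyBody.BoseGas.sideLength ρ N) * ∑ j, ((k : Fin 3 → ℤ) j : ℝ) * x j))) Ψ.ψ ≤ ENNReal.ofReal (θ * N)

end __Registered

/-- The alias IS the stub statement (definitional unfolding; documentation only). [folklore] -/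
example : __Registered.stub_kineticBudget ↔ (∀ v : ℝ → ENNReal, Literature.MathematicalPhysics.QuantumManyBody.BoseGas.IsRepulsiveFiniteRange v → ∃ C : ℝ, 0 < C ∧ ∃ ρ₀ : ℝ, 0 < ρ₀ ∧ ∀ ρ : ℝ, 0 < ρ → ρ < ρ₀ → ∀ᶠ N : ℕ in Filter.atTop, ∃ δ : ENNReal, 0 < δ ∧ ∀ Ψ : Literature.MathematicalPhysics.QuantumManyBody.BoseGas.TrialState N (Literature.MathematicalPhysics.QuantumManyBody.BoseGas.sideLength ρ N), Literature.MathematicalPhysics.QuantumManyBody.BoseGas.energy v Ψ ≤ Literature.MathematicalPhysics.QuantumManyBody.BoseGas.groundStateEnergy v N (Literature.MathematicalPhysics.QuantumManyBody.BoseGas.sideLength ρ N) + δ → (∫⁻ X, Literature.MathematicalPhysics.QuantumManyBody.BoseGas.kineticDensity Ψ.ψ X) ≤ ENNReal.ofReal (C * ρ * N)) := Iff.rfl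

/-- The alias IS the stub statement (definitional unfolding; documentation only). [folklore] -/
example : __Registered.stub_uvTailOfKineticBudget ↔ (∀ C : ℝ, 0 < C → ∃ K : ℝ, 0 < K ∧ ∃ θ : ℝ, θ < 1 ∧ ∀ ε : ℝ, 0 < ε → ε < 1 / 4 → ∀ ρ : ℝ, 0 < ρ → ∀ᶠ N : ℕ in Filter.atTop, ∀ Ψ : Literature.MathematicalPhysics.QuantumManyBody.BoseGas.TrialState N (Literature.MathematicalPhysics.QuantumManyBody.BoseGas.sideLength ρ N), (∫⁻ X, Literature.MathematicalPhysics.QuantumManyBody.BoseGas.kineticDensity Ψ.ψ X) ≤ ENNReal.ofReal (C * ρ * N) → ∑' k : {k : Fin 3 → ℤ // K * Real.sqrt ρ * Literature.MathematicalPhysics.QuantumManyBody.BoseGas.sideLength ρ N < ‖(fun j => (k j : ℝ))‖}, Literature.MathematicalPhysics.QuantumManyBody.BoseGas.occupation N ({x : EuclideanSpace ℝ (Fin 3) | ∀ j, x j ∈ Set.Ioo (ε * Literature.MathematicalPhysics.QuantumManyBody.BoseGas.sideLength ρ N) (Literature.MathematicalPhysics.QuantumManyBody.BoseGas.sideLength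 ρ N - ε * Literature.MathematicalPhysics.QuantumManyBody.BoseGas.sideLength ρ N)}.indicator fun x => ((Real.sqrt (((1 - 2 * ε) * Literature.MathematicalPhysics.QuantumManyBody.BoseGas.sideLength ρ N) ^ 3))⁻¹ : ℂ) * Complex.exp (Complex.I * ↑(2 * Real.pi / ((1 - 2 * ε) * Literature.MathematicalPhysics.QuantumManyBody.BoseGas.sideLength ρ N) * ∑ j, ((k : Fin 3 → ℤ) j : ℝ) * x j))) Ψ.ψ ≤ ENNReal.ofReal (θ * N)) := Iff.rfl


/-! ### The assembly -/

/-- THE SKELETON THEOREM, HYPOTHESIS FORM (real proof, no `sorry`; pure logic): the two stub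
statements — each under its REGISTERED NAME, as the reducible aliases `__Registered.stub_kineticBudget`
/ `__Registered.stub_uvTailOfKineticBudget` of their verbatim signatures — imply the crux
`BECInfraredBound.BecUvTail` BY NAME. Bookkeeping: the budget constant `C` of stub 1 is fed to
stub 2, which returns `K, θ`; `ρ₀ :=` stub 1's; for `0 < ρ < ρ₀` intersect the two `∀ᶠ N`
eventualities (`Filter.Eventually.and` via `filter_upwards`); `δ :=` stub 1's; for a δ-near-minimiser
the kinetic budget of stub 1 is the hypothesis of stub 2. [folklore] -/
theorem BecUvTail_of :
    __Registered.stub_kineticBudget →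
    __Registered.stub_uvTailOfKineticBudget →
    Summit.AtomisticToContinuum.BoseEinsteinCondensation.Theses.BECInfraredBound.BecUvTail := by
  intro h1 h2 v hv
  obtain ⟨C, hC, ρ₀, hρ₀, H1⟩ := h1 v hv
  obtain ⟨K, hK, θ, hθ, H2⟩ := h2 C hC
  refine ⟨K, hK, θ, hθ, fun ε hε hε4 => ⟨ρ₀, hρ₀, fun ρ hρ hρρ₀ => ?_⟩⟩
  filter_upwards [H1 ρ hρ hρρ₀, H2 ε hε hε4 ρ hρ] with N hN1 hN2
  obtain ⟨δ, hδ, hΨ⟩ := hN1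
  exact ⟨δ, hδ, fun Ψ hE => hN2 Ψ (hΨ Ψ hE)⟩

/-- THE SKELETON THEOREM, CLOSED FORM: the crux `BECInfraredBound.BecUvTail` from the two declared
stubs (its only `sorry`s are the stubs'; the composition is `BecUvTail_of`). [folklore] -/
theorem BecUvTail_of_stubs :
    Summit.AtomisticToContinuum.BoseEinsteinCondensation.Theses.BECInfraredBound.BecUvTail :=
  BecUvTail_of stub_kineticBudget stub_uvTailOfKineticBudget

end Summit.AtomisticToContinuum.BoseEinsteinCondensation.Cruxes.BecUvTail.Birth
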